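import Summits.Schanuel.Schanuel.Theorems.RootDecomp1KCor52Holds02

/-!
# RootDecomp1KCor52Holds — lens 6, generation 21 «GENERAL COR. 5.2, HYPOTHESIS-FREE» (RULE K-R29 (i), FRAME G21, LANE T): the registered Literature named fact `Literature.Barriers.Schanuel.NesterenkoPhilippon2001_ch3_cor_5_2` (LNM 1752 Ch. 3 Cor. 5.2 in PRINT GENERALITY: every q with 0 < |q| < 1, every ξ ∈ ℂ³ over which q, P(q), Q(q), R(q) are algebraic) DISCHARGED BY NAME — `theorem NesterenkoPhilippon2001_ch3_cor_5_2_holds : NesterenkoPhilippon2001_ch3_cor_5_2` from tree theorems only (Thm 1.1, Thm 5.1 at r = 3, Props 4.8 / 4.11, the norm step of p. 47) — continuation (RootDecomp1KCor52Holds03): §4 norm-step algebra (fractions, entry bounds, the matrix 𝔄_A) + §4d the evaluation identity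

(lens-6 g21 HOME kernel Cor52.lean 7faa26d9…, 1013 l, ONE import = tree RootDecomp1KPiScale01, namespace `Summit.Schanuel.Schanuel.Theorems.RootDecomp1KCor52`; CLAIM L2014, FRAME G21 L2016, NODE L2073 / RESULT L2074, critic VERDICT L2077 (crit g8: CLEARED — THEOREM ×1, the registered Literature fact discharged BY NAME in print generality; lens-6 tally THEOREM ×4 + CELL ×3; PORT NOW Summit-side, `--supports stmt-Schanuel-33363` = the PiCells/Hyper consumers it un-conditions; Literature relocation = later ops hoist of the four Summit helpers); Summit-side home because the kernel uses Summit helpers (`mvlen` algebra Hyper03/42, det bounds Hyper47, `natAbs_coeff_sup_le_mvlen` PiCells, `norm_mvaeval_le_mvlen_mul_pow` RelLiouvilleCell01) — NODE-g21.md §5; port by census-1 gen 18 as `RootDecomp1KCor52Holds01`–`05`: 01 = §1 transcendence-degree bookkeeping (`Kq`, `Lq`, `bookkeeping`) + §2 a dependent Ramanujan point lies on a prime form (`exists_prime_form_of_dependent`, `span_prime_form`); 02 = §3 the measure (31) at EVERY dependent Ramanujan point (`measure31_of_dependent`); 03 = §4 norm-step algebra (`exists_int_frac`, `exists_common_den`,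 `EB` entry bounds, `wt`, `matA`, `EB_matA`, `det_matA_bounds`) + §4d the evaluation identity (`ringHom_aeval_eq_sum`, `mapMatrix_matA`); 04 = §4e `norm_step_algebra` (B := det 𝔄_A, B(ω) = δ^{nD}·N_{L/K}(A(ξ))); 05 = §4e `norm_step` (analysis) + §5 `NesterenkoPhilippon2001_ch3_cor_5_2_holds` and the binder-free `{π, e^π, Γ(1/4)}` clause `NesterenkoPhilippon2001_ch3_cor_5_2_pi`.
PORT EDITS: `set_option linter.dupNamespace false` dropped; twelve one-line docstrings added; six generic helpers made `private` (`trdeg_adjoin_le_of_isAlgebraic`, `isAlgebraic_of_mem_adjoin`, `four_le_trdeg_of_algebraicIndependent`, `one_le_log_of_exp_le`, `ringHom_mvaeval`, `mapMatrix_smul` — tree twins exist) with per-part private copies; the three scoped `synthInstance.maxHeartbeats 400000 in` and `attribute [local instance] MvPolynomial.gradedAlgebra` kept in 01–02 (precedent PiScale01); statements and proofs verbatim EXCEPT the reviewer's revision of part 03 (review of p827651): `def wt` / `wt_le_totalDegree` deleted in favour of Mathlib's `Finsupp.degree` (`α.degree` in `matA`, `EB_matA`, `mapMatrix_matA`, `norm_step`;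 `rw [Finsupp.degree_eq_sum, Fin.sum_univ_three]` where the three-term form is needed) and the unused `attribute [local instance] MvPolynomial.gradedAlgebra` dropped from parts 03–05, and `structure EB … : Prop` turned into the proof-neutral `def EB … : Prop := 0 ≤ l ∧ ∀ a b, …` (the lens's 14:29Z draft form; critic L2077/L2082). `--supports stmt-Schanuel-33363`; no census credit carried; rung 0 — nothing here proves Schanuel.)
-/

noncomputable section

open Complex IntermediateField
open MvPolynomial (aeval rename X C)
open Literature.NumberTheory.Transcendental
open Literature.NumberTheory.Transcendental.Nesterenko
open Literature.Barriers.Schanuel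
open Summit.Schanuel.Schanuel.Theorems.RootDecomp1KHyper

namespace Summit.Schanuel.Schanuel.Theorems.RootDecomp1KCor52

/-! ## §4  The norm step of p. 47 — algebra: integer fractions in `ℚ(ω)`, polynomial matrices, the matrix `𝔄_A`

Throughout `ω : Fin 4 → ℂ` is any point, `K = ℚ(ω)`; integer-polynomial matrices are `Matrix (Fin D) (Fin D) ℤ[y₁,…,y₄]`. -/

section NormAlgebra

variable {m : ℕ}

/-- Ring homomorphisms commute with the evaluation of INTEGER polynomials. -/
private theorem ringHom_mvaeval {S T : Type*} [CommRing S] [CommRing T] [Algebra ℤ S] [Algebra ℤ T] {n : ℕ}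
    (φ : S →+* T) (g : Fin n → S) (A : MvPolynomial (Fin n) ℤ) :
    φ (aeval g A) = aeval (fun i => φ (g i)) A := by
  induction A using MvPolynomial.induction_on with
  | C a => simp
  | add p r hp hr => simp only [map_add, hp, hr]
  | mul_X p i hp => simp only [map_mul, MvPolynomial.aeval_X, hp]

/-- Every element of `ℚ(ω)` is a quotient `R(ω)/S(ω)` of INTEGER polynomials with `S(ω) ≠ 0`. -/
theorem exists_int_frac (ω : Fin m → ℂ) {x : ℂ} (hx : x ∈ adjoin ℚ (Set.range ω)) :
    ∃ R S : MvPolynomial (Fin m) ℤ, aeval ω S ≠ 0 ∧ x * aeval ω S = aeval ω R := by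
  obtain ⟨r, s, hrs⟩ := (mem_adjoin_range_iff ℚ ω x).mp hx
  by_cases hs : aeval ω s = 0
  · refine ⟨0, 1, by rw [map_one]; exact one_ne_zero, ?_⟩
    rw [hrs, hs, div_zero, zero_mul, map_zero]
  obtain ⟨Nr, Rz, hNr, hr⟩ := exists_int_mul_eq_map r
  obtain ⟨Ns, Sz, hNs, hs'⟩ := exists_int_mul_eq_map s
  have hRz : aeval ω Rz = (Nr : ℂ) * aeval ω r := by
    rw [← mvaeval_int_map, hr, map_mul, MvPolynomial.aeval_C]; simp
  have hSz : aeval ω Sz = (Ns : ℂ) * aeval ω s := by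
    rw [← mvaeval_int_map, hs', map_mul, MvPolynomial.aeval_C]; simp
  refine ⟨C Ns * Rz, C Nr * Sz, ?_, ?_⟩
  · rw [map_mul, MvPolynomial.aeval_C, hSz, algebraMap_int_eq, eq_intCast]
    exact mul_ne_zero (by exact_mod_cast hNr) (mul_ne_zero (by exact_mod_cast hNs) hs)
  · rw [map_mul, map_mul, MvPolynomial.aeval_C, MvPolynomial.aeval_C, hSz, hRz, algebraMap_int_eq, eq_intCast,
      eq_intCast, hrs]
    field_simp

/-- A COMMON DENOMINATOR for finitely many elements of `ℚ(ω)`. -/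
theorem exists_common_den (ω : Fin m → ℂ) {ι : Type*} [Fintype ι] [DecidableEq ι] (f : ι → ℂ)
    (hf : ∀ i, f i ∈ adjoin ℚ (Set.range ω)) :
    ∃ (S : MvPolynomial (Fin m) ℤ) (R : ι → MvPolynomial (Fin m) ℤ), aeval ω S ≠ 0 ∧
      ∀ i, f i * aeval ω S = aeval ω (R i) := by
  choose R S hS hRS using fun i => exists_int_frac ω (hf i)
  refine ⟨∏ i, S i, fun i => R i * ∏ j ∈ Finset.univ.erase i, S j, ?_, fun i => ?_⟩
  · rw [map_prod]; exact Finset.prod_ne_zero_iff.mpr fun i _ => hS i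
  · rw [map_prod, map_mul, map_prod, ← Finset.mul_prod_erase Finset.univ (fun j => aeval ω (S j))
      (Finset.mem_univ i), ← mul_assoc, hRS i]

/-- ENTRY BOUNDS of an integer-polynomial matrix: every entry has total degree `≤ g` and length `≤ l`. -/
def EB {D : ℕ} (M : Matrix (Fin D) (Fin D) (MvPolynomial (Fin m) ℤ)) (g : ℕ) (l : ℤ) : Prop :=
  0 ≤ l ∧ ∀ a b, (M a b).totalDegree ≤ g ∧ mvlen (M a b) ≤ l

/-- Entry bounds are monotone in the degree and length bounds. -/
theorem EB.mono {D : ℕ} {M : Matrix (Fin D) (Fin D) (MvPolynomial (Fin m) ℤ)} {g g' : ℕ} {l l' : ℤ}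
    (h : EB M g l) (hg : g ≤ g') (hl : l ≤ l') : EB M g' l' :=
  ⟨h.1.trans hl, fun a b => ⟨(h.2 a b).1.trans hg, (h.2 a b).2.trans hl⟩⟩

/-- Entry bounds of the identity matrix: degree `0`, length `1`. -/
theorem EB_one {D : ℕ} : EB (1 : Matrix (Fin D) (Fin D) (MvPolynomial (Fin m) ℤ)) 0 1 := by
  refine ⟨zero_le_one, fun a b => ?_⟩
  rw [Matrix.one_apply]
  split_ifs
  · exact ⟨by rw [MvPolynomial.totalDegree_one], by rw [mvlen_one]⟩
  · exact ⟨by rw [MvPolynomial.totalDegree_zero], by rw [mvlen_zero]; exact zero_le_one⟩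

/-- Entry bounds of a product: degrees add, lengths multiply with a factor `D`. -/
theorem EB_mul {D : ℕ} {M N : Matrix (Fin D) (Fin D) (MvPolynomial (Fin m) ℤ)} {g₁ g₂ : ℕ} {l₁ l₂ : ℤ}
    (hM : EB M g₁ l₁) (hN : EB N g₂ l₂) : EB (M * N) (g₁ + g₂) ((D : ℤ) * (l₁ * l₂)) := by
  refine ⟨by have := hM.1; have := hN.1; positivity, fun a b => ?_⟩
  rw [Matrix.mul_apply]
  refine ⟨MvPolynomial.totalDegree_finsetSum_le fun j _ =>
    (MvPolynomial.totalDegree_mul _ _).trans (add_le_add (hM.2 a j).1 (hN.2 j b).1), ?_⟩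
  refine (mvlen_sum_le _ _).trans ?_
  calc ∑ j, mvlen (M a j * N j b) ≤ ∑ _j : Fin D, l₁ * l₂ :=
        Finset.sum_le_sum fun j _ => (mvlen_mul_le _ _).trans
          (mul_le_mul (hM.2 a j).2 (hN.2 j b).2 (mvlen_nonneg _) hM.1)
    _ = (D : ℤ) * (l₁ * l₂) := by rw [Finset.sum_const, Finset.card_univ, Fintype.card_fin, nsmul_eq_mul]

/-- Entry bounds of a power `M ^ k`: degree `k·g`, length `(D·l)^k`. -/
theorem EB_pow {D : ℕ} {M : Matrix (Fin D) (Fin D) (MvPolynomial (Fin m) ℤ)} {g : ℕ} {l : ℤ}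
    (hM : EB M g l) (k : ℕ) : EB (M ^ k) (k * g) (((D : ℤ) * l) ^ k) := by
  induction k with
  | zero => rw [pow_zero, zero_mul, pow_zero]; exact EB_one
  | succ k ih =>
    rw [pow_succ, Nat.succ_mul, pow_succ]
    have h := EB_mul ih hM
    refine h.mono le_rfl (le_of_eq ?_)
    ring

/-- Entry bounds of `p • M` for a polynomial scalar `p`. -/
theorem EB_smul {D : ℕ} {M : Matrix (Fin D) (Fin D) (MvPolynomial (Fin m) ℤ)} {g gp : ℕ} {l lp : ℤ}
    (hM : EB M g l) (p : MvPolynomial (Fin m) ℤ) (hpg : p.totalDegree ≤ gp) (hpl : mvlen p ≤ lp) :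
    EB (p • M) (gp + g) (lp * l) := by
  have hlp : 0 ≤ lp := (mvlen_nonneg _).trans hpl
  refine ⟨mul_nonneg hlp hM.1, fun a b => ?_⟩
  rw [Matrix.smul_apply, smul_eq_mul]
  exact ⟨(MvPolynomial.totalDegree_mul _ _).trans (add_le_add hpg (hM.2 a b).1),
    (mvlen_mul_le _ _).trans (mul_le_mul hpl (hM.2 a b).2 (mvlen_nonneg _) hlp)⟩

/-- Entry bounds of a finite sum of matrices with a common degree bound. -/
theorem EB_sum {D : ℕ} {ι : Type*} (s : Finset ι) (F : ι → Matrix (Fin D) (Fin D) (MvPolynomial (Fin m) ℤ))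
    {g : ℕ} {l : ι → ℤ} (h : ∀ i ∈ s, EB (F i) g (l i)) : EB (∑ i ∈ s, F i) g (∑ i ∈ s, l i) := by
  refine ⟨Finset.sum_nonneg fun i hi => (h i hi).1, fun a b => ?_⟩
  rw [Matrix.sum_apply]
  exact ⟨MvPolynomial.totalDegree_finsetSum_le fun i hi => ((h i hi).2 a b).1,
    (mvlen_sum_le _ _).trans (Finset.sum_le_sum fun i hi => ((h i hi).2 a b).2)⟩

/-- **The matrix `𝔄_A`** of p. 47: `Σ_α a_α · 𝔇^{n−|α|} · 𝔊₀^{α₀} 𝔊₁^{α₁} 𝔊₂^{α₂}` for `A = Σ_α a_α y^α` of degree `n`. -/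
def matA {D : ℕ} (G : Fin 3 → Matrix (Fin D) (Fin D) (MvPolynomial (Fin m) ℤ)) (Dn : MvPolynomial (Fin m) ℤ)
    (A : MvPolynomial (Fin 3) ℤ) : Matrix (Fin D) (Fin D) (MvPolynomial (Fin m) ℤ) :=
  ∑ α ∈ A.support, (C (A.coeff α) * Dn ^ (A.totalDegree - α.degree)) • ((G 0) ^ (α 0) * (G 1) ^ (α 1) * (G 2) ^ (α 2))

/-- Entry bounds of `𝔄_A`: degree `≤ n·g`, length `≤ len(A) · D² · (D l)^n`. -/
theorem EB_matA {D : ℕ} (hD : 1 ≤ D) {G : Fin 3 → Matrix (Fin D) (Fin D) (MvPolynomial (Fin m) ℤ)}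
    {Dn : MvPolynomial (Fin m) ℤ} {g : ℕ} {l : ℤ} (hl : 1 ≤ l) (hG : ∀ i, EB (G i) g l)
    (hDg : Dn.totalDegree ≤ g) (hDl : mvlen Dn ≤ l) (A : MvPolynomial (Fin 3) ℤ) :
    EB (matA G Dn A) (A.totalDegree * g) (mvlen A * ((D : ℤ) ^ 2 * ((D : ℤ) * l) ^ A.totalDegree)) := by
  have hl0 : 0 ≤ l := zero_le_one.trans hl
  have hD1 : (1 : ℤ) ≤ D := by exact_mod_cast hD
  have hlDl : l ≤ (D : ℤ) * l := le_mul_of_one_le_left hl0 hD1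
  have hDl1 : 1 ≤ (D : ℤ) * l := hl.trans hlDl
  unfold matA mvlen
  rw [Finset.sum_mul]
  refine EB_sum _ _ fun α hα => ?_
  set n := A.totalDegree with hn
  have hwt : α.degree ≤ n := MvPolynomial.le_totalDegree hα
  -- the matrix monomial
  have h0 := EB_pow (hG 0) (α 0)
  have h01 := EB_mul h0 (EB_pow (hG 1) (α 1))
  have h012 := EB_mul h01 (EB_pow (hG 2) (α 2))
  have hmono : EB ((G 0) ^ (α 0) * (G 1) ^ (α 1) * (G 2) ^ (α 2)) (α.degree * g)
      ((D : ℤ) ^ 2 * ((D : ℤ) * l) ^ (α.degree)) := by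
    refine h012.mono (le_of_eq ?_) (le_of_eq ?_)
    · rw [Finsupp.degree_eq_sum, Fin.sum_univ_three]; ring
    · rw [Finsupp.degree_eq_sum, Fin.sum_univ_three]; ring
  -- the scalar `a_α 𝔇^{n-|α|}`
  have hpg : (C (A.coeff α) * Dn ^ (n - α.degree)).totalDegree ≤ (n - α.degree) * g :=
    (MvPolynomial.totalDegree_mul _ _).trans (by
      rw [MvPolynomial.totalDegree_C, zero_add]
      exact (MvPolynomial.totalDegree_pow _ _).trans (Nat.mul_le_mul_left _ hDg))
  have hpl : mvlen (C (A.coeff α) * Dn ^ (n - α.degree)) ≤ |A.coeff α| * l ^ (n - α.degree) :=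
    (mvlen_C_mul_le _ _).trans (mul_le_mul_of_nonneg_left
      ((mvlen_pow_le _ _).trans (pow_le_pow_left₀ (mvlen_nonneg _) hDl _)) (abs_nonneg _))
  refine (EB_smul hmono _ hpg hpl).mono (le_of_eq ?_) ?_
  · rw [← Nat.add_mul, Nat.sub_add_cancel hwt]
  · have hpow : l ^ (n - α.degree) * ((D : ℤ) * l) ^ α.degree ≤ ((D : ℤ) * l) ^ n := by
      calc l ^ (n - α.degree) * ((D : ℤ) * l) ^ α.degree ≤ ((D : ℤ) * l) ^ (n - α.degree) * ((D : ℤ) * l) ^ α.degree :=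
            mul_le_mul_of_nonneg_right (pow_le_pow_left₀ hl0 hlDl _) (pow_nonneg (hl0.trans hlDl) _)
        _ = ((D : ℤ) * l) ^ n := by rw [← pow_add, Nat.sub_add_cancel hwt]
    calc |A.coeff α| * l ^ (n - α.degree) * ((D : ℤ) ^ 2 * ((D : ℤ) * l) ^ α.degree)
        = |A.coeff α| * (D : ℤ) ^ 2 * (l ^ (n - α.degree) * ((D : ℤ) * l) ^ α.degree) := by ring
      _ ≤ |A.coeff α| * (D : ℤ) ^ 2 * ((D : ℤ) * l) ^ n :=
          mul_le_mul_of_nonneg_left hpow (by positivity)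
      _ = |A.coeff α| * ((D : ℤ) ^ 2 * ((D : ℤ) * l) ^ n) := by ring

/-- Degree and length of `B_A := det 𝔄_A`. -/
theorem det_matA_bounds {D : ℕ} (hD : 1 ≤ D) {G : Fin 3 → Matrix (Fin D) (Fin D) (MvPolynomial (Fin m) ℤ)}
    {Dn : MvPolynomial (Fin m) ℤ} {g : ℕ} {l : ℤ} (hl : 1 ≤ l) (hG : ∀ i, EB (G i) g l)
    (hDg : Dn.totalDegree ≤ g) (hDl : mvlen Dn ≤ l) (A : MvPolynomial (Fin 3) ℤ) :
    (matA G Dn A).det.totalDegree ≤ D * (A.totalDegree * g) ∧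
      mvlen (matA G Dn A).det ≤
        (Nat.factorial D : ℤ) * (mvlen A * ((D : ℤ) ^ 2 * ((D : ℤ) * l) ^ A.totalDegree)) ^ D := by
  have h := EB_matA hD hl hG hDg hDl A
  exact ⟨HyperCell.LatCell.totalDegree_det_le _ fun a b => (h.2 a b).1,
    HyperCell.LatCell.mvlen_det_le _ fun a b => (h.2 a b).2⟩

end NormAlgebra

/-! ## §4d  The evaluation identity `𝔄_A(ω) = δⁿ · ψ(A(ξ))` -/

section EvalIdentity

variable {m : ℕ}

/-- `f.mapMatrix (p • M) = f p • f.mapMatrix M`. -/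
private theorem mapMatrix_smul {R S : Type*} [CommSemiring R] [CommSemiring S] {D : ℕ} (f : R →+* S) (p : R)
    (M : Matrix (Fin D) (Fin D) R) : f.mapMatrix (p • M) = f p • f.mapMatrix M := by
  ext a b
  simp [Matrix.smul_apply, smul_eq_mul, map_mul]

/-- `ψ(A(ξ)) = Σ_α a_α • ψ(ξ₀)^{α₀} ψ(ξ₁)^{α₁} ψ(ξ₂)^{α₂}` for a ring homomorphism `ψ` into square matrices. -/
theorem ringHom_aeval_eq_sum {S : Type*} [CommRing S] [Algebra ℤ S] {D : ℕ}
    (ψ : S →+* Matrix (Fin D) (Fin D) ℂ) (ξL : Fin 3 → S) (A : MvPolynomial (Fin 3) ℤ) :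
    ψ (aeval ξL A) = ∑ α ∈ A.support, ((A.coeff α : ℤ) : ℂ) •
      ((ψ (ξL 0)) ^ (α 0) * (ψ (ξL 1)) ^ (α 1) * (ψ (ξL 2)) ^ (α 2)) := by
  conv_lhs => rw [A.as_sum]
  rw [map_sum, map_sum]
  refine Finset.sum_congr rfl fun α _ => ?_
  rw [MvPolynomial.aeval_monomial, map_mul, Finsupp.prod_fintype _ _ (fun i => pow_zero _), Fin.prod_univ_three,
    map_mul, map_mul, map_pow, map_pow, map_pow, eq_intCast, map_intCast, ← zsmul_eq_mul,
    Int.cast_smul_eq_zsmul]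

/-- **`𝔄_A(ω) = 𝔇(ω)ⁿ · ψ(A(ξ))`**: if `𝔊ᵢ(ω) = 𝔇(ω) · ψ(ξᵢ)` entrywise (`ψ` a ring homomorphism from a
commutative ring containing the `ξᵢ` into `D × D` complex matrices), then the integer-polynomial matrix `𝔄_A`
evaluates at `ω` to `𝔇(ω)^{deg A} · ψ(A(ξ))`. -/
theorem mapMatrix_matA {D : ℕ} (ω : Fin m → ℂ) {S : Type*} [CommRing S] [Algebra ℤ S]
    (ψ : S →+* Matrix (Fin D) (Fin D) ℂ) (ξL : Fin 3 → S)
    (G : Fin 3 → Matrix (Fin D) (Fin D) (MvPolynomial (Fin m) ℤ)) (Dn : MvPolynomial (Fin m) ℤ)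
    (hG : ∀ i, ((aeval ω : MvPolynomial (Fin m) ℤ →ₐ[ℤ] ℂ) : MvPolynomial (Fin m) ℤ →+* ℂ).mapMatrix (G i) =
      aeval ω Dn • ψ (ξL i))
    (A : MvPolynomial (Fin 3) ℤ) :
    ((aeval ω : MvPolynomial (Fin m) ℤ →ₐ[ℤ] ℂ) : MvPolynomial (Fin m) ℤ →+* ℂ).mapMatrix (matA G Dn A) =
      aeval ω Dn ^ A.totalDegree • ψ (aeval ξL A) := by
  rw [ringHom_aeval_eq_sum, Finset.smul_sum]
  unfold matA
  rw [map_sum]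
  refine Finset.sum_congr rfl fun α hα => ?_
  have hwt : α.degree ≤ A.totalDegree := MvPolynomial.le_totalDegree hα
  rw [mapMatrix_smul]
  simp only [map_mul, map_pow, hG, RingHom.coe_coe]
  rw [MvPolynomial.aeval_C, eq_intCast, smul_pow, smul_pow, smul_pow, smul_mul_smul_comm, smul_mul_smul_comm,
    smul_smul, smul_smul]
  congr 1
  have hpow : aeval ω Dn ^ (A.totalDegree - α.degree) * (aeval ω Dn ^ (α 0) * aeval ω Dn ^ (α 1) *
      aeval ω Dn ^ (α 2)) = aeval ω Dn ^ A.totalDegree := by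
    rw [← pow_add, ← pow_add, ← pow_add]
    congr 1
    rw [Finsupp.degree_eq_sum, Fin.sum_univ_three] at hwt ⊢
    omega
  linear_combination ((A.coeff α : ℤ) : ℂ) * hpow

end EvalIdentity

end Summit.Schanuel.Schanuel.Theorems.RootDecomp1KCor52

end
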